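/-
Copyright (c) 2026. All rights reserved.
Released under Apache 2.0 license as described in the file LICENSE.
Authors: abc-iut cell, block C / W6 prover seat abc-iut-w6-d060 (gen 2).
-/
import Literature.IUT.LogVolume.UnitLogBoundaryRamificationRoots
import HarnessLib

/-!
# `log_p(𝒪_K^×)` at `e = p − 1`, III: the TRICHOTOMY

Third PROOF-ONLY file (no `def`, no named fact) of the boundary-ramification computation of the image
of the `p`-adic logarithm on units (`UnitLogBoundaryRamification`, `UnitLogBoundaryRamificationRoots`).
Setting: `K` a proper ultrametric normed `ℚ_p`-algebra (a finite extension of `ℚ_p`), `p` ODD,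
`absRamificationIdx p K = p − 1`, `ϖ` a uniformizer, `𝔪 = {‖z‖ ≤ ‖ϖ‖}`, `𝔪² = {‖z‖ ≤ ‖ϖ‖²}`,
`f = residueDegree p K`.  THE TRICHOTOMY:

* (W1) `logUnits_eq_closedBall_of_forall_pow_prime_eq_one`: if `K` has NO non-trivial `p`-th root of
  unity then `log_p(𝒪^×) = 𝔪` — the tame formula `log_p(𝒪^×) = p^{1/e}·𝒪` of [IUTchIV] Prop. 1.2 (i)
  persists at the boundary `e = p − 1`;
* (W2) `logUnits_eq_closedBall_sq_of_residueDegree_eq_one`: if `K` contains a non-trivial `p`-th root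
  of unity and `f = 1` (so `K ≅ ℚ_p(ζ_p)`) then `log_p(𝒪^×) = 𝔪²`;
* (W3) `exists_mul_not_mem_logUnits`: if `K` contains a non-trivial `p`-th root of unity and `f ≥ 2`
  then `log_p(𝒪^×)` is NOT stable under multiplication by `𝒪` (it contains an element of norm `‖ϖ‖`,
  `exists_mem_logUnits_norm_eq`, but is not `𝔪`); consequently NO ball `{‖z‖ ≤ s}` is `c • log_p(𝒪^×)`
  for a scalar `c ∈ ℚ_p^×` (`closedBall_ne_smul_logUnits`).

Mechanism (files I–II): modulo `𝔪²`, `log_p(1 + ϖa) ≡ ϖ·(a + c·a^p)` with the unit `c = ϖ^{p−1}/p`;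
the residue polynomial `ā ↦ ā + c̄·ā^p` on `k = 𝒪/𝔪` (`#k = p^f`) is additive with kernel of order `1`
or `p`, the latter iff `K ∋ ζ_p ≠ 1`; (W1): kernel trivial ⇒ onto ⇒ `𝔪 ⊆ log_p(𝒪^×) + 𝔪² = log_p(𝒪^×)`;
(W2): `#k = p` and a non-zero zero ⇒ the polynomial vanishes ⇒ `log_p(1 + 𝔪) ⊆ 𝔪²`; (W3): were
`log_p(𝒪^×)` an `𝒪`-module between `𝔪²` and `𝔪` it would be `𝔪²` (impossible: `γ ≠ 0` and vanishing
polynomial force `#k ≤ p`) or `𝔪` (impossible: onto ⇒ one-to-one, but `(ζ−1)/ϖ` is a non-zero zero).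

Consumer: the Dupuy–Hilado (Ind2) BALL-MOVER CRITERION of `Summits/ABC/IUTFork/Thm311RealIsmDHMoverCriterion`
(abc-iut-w5-d180, p432150: `t·𝒪_v` is fixed by all of (Ind2) iff `t·𝒪_v = p^k·log_p(𝒪_v^×)` for some `k`),
whose tame evaluation stops at `e ≤ p − 2`.  References: [cite: NeukirchANT1999, Ch. II Prop. (5.5)–(5.7)]
[cite: Koblitz1984, Ch. IV §1–2] [cite: Washington1997, Lemma 1.4, §5.1].  Classical; `logUnits` is the
cell's typing of [IUTchIV] Prop. 1.2's `log_p(R^×)` ([claim: Mochizuki2012, status: disputed] for that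
locution only).
-/

noncomputable section

open Metric Set IsUltrametricDist IsLocalRing
open scoped Pointwise NormedField

namespace Literature.IUT.LogVolume

open Literature.NumberTheory.GaloisRepresentations.Ultrametric Literature.NumberTheory.Transcendental
open BoundaryRamification

variable (p : ℕ) [hp : Fact p.Prime]
variable {K : Type*} [NontriviallyNormedField K] [instK : NormedAlgebra ℚ_[p] K] [IsUltrametricDist K]
  [ProperSpace K]
variable {ϖ : Kˣ} (hϖ : IsUniformizer ϖ) (he : absRamificationIdx p K = p - 1)
include hϖ he

namespace BoundaryRamification

/-! ## 0. Bookkeeping -/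

omit [IsUltrametricDist K] [ProperSpace K] he in
/-- A principal unit is `1 + ϖ·a` with `a ∈ 𝒪`. [cite: NeukirchANT1999, Ch. II Prop. (5.3)] -/
theorem exists_eq_one_add_mul_of_isPrincipal {y : K} (hy : IsPrincipal y) :
    ∃ a : K, ‖a‖ ≤ 1 ∧ y = 1 + (ϖ : K) * a := by
  have hϖ0 : (ϖ : K) ≠ 0 := ϖ.ne_zero
  refine ⟨(y - 1) / ϖ, ?_, ?_⟩
  · rw [norm_div, div_le_one (norm_units_pos ϖ), ← norm_neg, neg_sub]
    exact hϖ.norm_le_of_norm_lt_one _ hy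
  · rw [mul_div_cancel₀ _ hϖ0]; ring

/-- **If `ϖ·b ∈ log_p(𝒪^×)` (`b ∈ 𝒪`) then `b ≡ a + c·a^p (mod 𝔪)` for some `a ∈ 𝒪`** — i.e. `(log_p(𝒪^×))/𝔪² ⊆ ϖ·(image of the residue
polynomial)`.  (`ϖb = log_p u`, `u^m = 1 + ϖa'` principal with `p ∤ m`, so `a' + c·a'^p ≡ m·b`; then
`a := n·a'` with `nm ≡ 1 (mod p)`, by `𝔽_p`-linearity.) [cite: Washington1997, §5.1] -/
theorem exists_norm_addPoly_sub_lt_one_of_mul_mem_logUnits (hp2 : p ≠ 2) {b : K} (hb : ‖b‖ ≤ 1)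
    (hmem : (ϖ : K) * b ∈ logUnits K) :
    ∃ a : K, ‖a‖ ≤ 1 ∧ ‖a + (ϖ : K) ^ (p - 1) / p * a ^ p - b‖ < 1 := by
  haveI := IwasawaLog.charZero p (F := K)
  have hϖ0 : (ϖ : K) ≠ 0 := ϖ.ne_zero
  have hc1 := norm_coeff_eq_one p hϖ he
  let C : Valued.integer K := ⟨(ϖ : K) ^ (p - 1) / p, Valued.integer.mem_iff.mpr hc1.le⟩
  have hCK : (C : K) = (ϖ : K) ^ (p - 1) / p := rfl
  obtain ⟨u, hu, hux⟩ := hmem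
  rw [Set.mem_setOf_eq] at hu
  obtain ⟨m, hm, hpm, hmP⟩ := exists_pow_isPrincipal_not_dvd (p := p) hu
  have hm0 : ((m : ℕ) : K) ≠ 0 := by exact_mod_cast hm.ne'
  have hLm : logSeries (u ^ m) = (ϖ : K) * ((m : K) * b) := by
    have h := unitLog_eq_inv_mul_logSeries p hm hmP
    rw [hux] at h
    calc logSeries (u ^ m) = (m : K) * (((m : ℕ) : K)⁻¹ * logSeries (u ^ m)) := by
          rw [← mul_assoc, mul_inv_cancel₀ hm0, one_mul]
      _ = (ϖ : K) * ((m : K) * b) := by rw [← h]; ring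
  obtain ⟨a', ha', hy⟩ := exists_eq_one_add_mul_of_isPrincipal hϖ hmP
  have h1 : ‖a' + (C : K) * a' ^ p - (m : K) * b‖ < 1 := by
    refine norm_sub_lt_one_of_norm_logSeries_sub_mul_le_sq p hϖ he hp2 ha' ?_
    rw [← hy, hLm, sub_self, norm_zero]; positivity
  -- invert `m` modulo `p`
  have hcop : Nat.Coprime m p := ((Nat.Prime.coprime_iff_not_dvd hp.out).mpr hpm).symm
  obtain ⟨n, -, hn⟩ := Nat.exists_mul_mod_eq_one_of_coprime hcop hp.out.one_lt
  have hmn1 : 1 ≤ m * n := by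
    by_contra h0
    have : m * n = 0 := by omega
    rw [this, Nat.zero_mod] at hn
    exact zero_ne_one hn
  have hnK : ‖(n : K)‖ ≤ 1 := by
    rw [norm_natCast_eq_padicNorm p K n]; exact_mod_cast Padic.norm_int_le_one (n : ℤ)
  refine ⟨(n : K) * a', ?_, ?_⟩
  · rw [norm_mul]; exact mul_le_one₀ hnK (norm_nonneg _) ha'
  · have h2 := norm_natCast_mul_addPoly_sub_lt_one p C n a' ha'
    have h3 : ‖(n : K) * (a' + (C : K) * a' ^ p) - b‖ < 1 := by
      have hsplit : (n : K) * (a' + (C : K) * a' ^ p) - b =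
          (n : K) * (a' + (C : K) * a' ^ p - (m : K) * b) + (((m * n : ℕ) : K) - 1) * b := by
        push_cast; ring
      rw [hsplit]
      refine (norm_add_le_max _ _).trans_lt (max_lt ?_ ?_)
      · rw [norm_mul]; exact (mul_le_of_le_one_left (norm_nonneg _) hnK).trans_lt h1
      · rw [norm_mul]
        refine (mul_le_of_le_one_right (norm_nonneg _) hb).trans_lt ?_
        have hdvd : p ∣ m * n - 1 :=
          (Nat.modEq_iff_dvd' hmn1).mp ((Nat.mod_eq_of_lt hp.out.one_lt).trans hn.symm)
        rw [show (((m * n : ℕ) : K) - 1) = ((m * n - 1 : ℕ) : K) by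
          rw [Nat.cast_sub hmn1, Nat.cast_one], norm_natCast_eq_padicNorm p K]
        exact Padic.norm_natCast_lt_one_iff.mpr hdvd
    have hsplit2 : (n : K) * a' + (ϖ : K) ^ (p - 1) / p * ((n : K) * a') ^ p - b =
        (((n : K) * a' + (C : K) * ((n : K) * a') ^ p) - (n : K) * (a' + (C : K) * a' ^ p)) +
          ((n : K) * (a' + (C : K) * a' ^ p) - b) := by rw [hCK]; ring
    rw [hsplit2]
    exact (norm_add_le_max _ _).trans_lt (max_lt h2 h3)

end BoundaryRamification

/-! ## (W1) No non-trivial `p`-th root of unity: `log_p(𝒪^×) = 𝔪` -/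

/-- **(W1)** At `e = p − 1`, `p` odd: if `K` has NO non-trivial `p`-th root of unity then
**`log_p(𝒪_K^×) = 𝔪_K = {‖z‖ ≤ ‖ϖ‖}`** (= `p^{1/e}·𝒪_K`, the formula of [IUTchIV] Prop. 1.2 (i) beyond its
tame range).  Proof: the residue polynomial `ā ↦ ā + c̄·ā^p` has trivial kernel (a unit zero would lift to
a non-trivial `ζ_p`), hence is onto the finite residue field; so every `z ∈ 𝔪` is `log_p(1 + ϖa)` up to an
element of `𝔪² ⊆ log_p(𝒪^×)`. [cite: Washington1997, §5.1] [cite: NeukirchANT1999, Ch. II Prop. (5.7)] -/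
theorem logUnits_eq_closedBall_of_forall_pow_prime_eq_one (hp2 : p ≠ 2)
    (hμ : ∀ ζ : K, ζ ^ p = 1 → ζ = 1) : logUnits K = closedBall (0 : K) ‖(ϖ : K)‖ := by
  refine Set.Subset.antisymm (logUnits_subset_closedBall p hϖ he) fun z hz => ?_
  rw [mem_closedBall, dist_zero_right] at hz
  have hϖ0 : (ϖ : K) ≠ 0 := ϖ.ne_zero
  have hc1 := norm_coeff_eq_one p hϖ he
  let C : Valued.integer K := ⟨(ϖ : K) ^ (p - 1) / p, Valued.integer.mem_iff.mpr hc1.le⟩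
  haveI := charP_residueField p K
  haveI : Finite (ResidueField (Valued.integer K)) := finite_residueField
  -- the residue polynomial has trivial kernel, hence is onto
  have hker := addPoly_ker_trivial_of_norm p C
    (fun a ha hΛ => norm_lt_one_of_norm_add_mul_pow_lt_one p hϖ he hp2 hμ ha hΛ)
  have hsurj := addPoly_surjective_of_ker p _ hker
  -- solve `a + c·a^p ≡ z/ϖ (mod 𝔪)`
  have hb : ‖z / ϖ‖ ≤ 1 := by rw [norm_div, div_le_one (norm_units_pos ϖ)]; exact hz
  obtain ⟨a, ha, hab⟩ := exists_norm_add_mul_pow_sub_lt_one_of_surjective p C hsurj (z / ϖ) hb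
  -- then `log_p(1 + ϖa) ≡ z (mod 𝔪²)`
  have hL := norm_logSeries_sub_mul_le_sq_of_norm_sub_lt_one p hϖ he hp2 ha hab
  rw [mul_div_cancel₀ _ hϖ0] at hL
  have h1 : z - logSeries (1 + (ϖ : K) * a) ∈ logUnits K :=
    closedBall_sq_subset_logUnits p hϖ he (by rw [mem_closedBall, dist_zero_right, norm_sub_rev]; exact hL)
  have hyP : IsPrincipal (1 + (ϖ : K) * a) := by
    rw [IsPrincipal, sub_add_cancel_left, norm_neg, norm_mul]
    exact (mul_le_of_le_one_right (norm_nonneg _) ha).trans_lt hϖ.norm_lt_one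
  have h2 : logSeries (1 + (ϖ : K) * a) ∈ logUnits K := by
    rw [← unitLog_of_isPrincipal p hyP]; exact unitLog_mem_logUnits hyP.norm_eq_one
  have h3 := (logUnitsAddSubgroup p K).add_mem h1 h2
  rwa [sub_add_cancel] at h3

/-! ## (W2) `ζ_p ∈ K`, `f = 1`: `log_p(𝒪^×) = 𝔪²` -/

/-- **(W2)** At `e = p − 1`, `p` odd: if `K` contains a non-trivial `p`-th root of unity `ζ` and has
residue degree `f = 1` (so `K ≅ ℚ_p(ζ_p)`) then **`log_p(𝒪_K^×) = 𝔪_K² = {‖z‖ ≤ ‖ϖ‖²}`**.  Proof: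
`(ζ − 1)/ϖ` is a non-zero zero of the additive residue polynomial on a residue field of prime order `p`, so
the polynomial vanishes identically, i.e. `log_p(1 + 𝔪) ⊆ 𝔪²`; `⊇` is the sandwich. (The tree's
`UnitLogCyclotomicPrime.logUnits_eq_closedBall_sq` is the global cyclotomic instance `K = ℚ(ζ_p)_{(ζ_p−1)}`.)
[cite: Washington1997, Lemma 1.4, §5.1] [cite: NeukirchANT1999, Ch. II Prop. (5.7)] -/
theorem logUnits_eq_closedBall_sq_of_residueDegree_eq_one (hp2 : p ≠ 2) {ζ : K} (hζ : ζ ^ p = 1)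
    (hζ1 : ζ ≠ 1) (hf : residueDegree p K = 1) :
    logUnits K = closedBall (0 : K) (‖(ϖ : K)‖ ^ 2) := by
  refine Set.Subset.antisymm ?_ (closedBall_sq_subset_logUnits p hϖ he)
  have hc1 := norm_coeff_eq_one p hϖ he
  let C : Valued.integer K := ⟨(ϖ : K) ^ (p - 1) / p, Valued.integer.mem_iff.mpr hc1.le⟩
  haveI := charP_residueField p K
  haveI : Finite (ResidueField (Valued.integer K)) := finite_residueField
  -- a non-zero zero of the residue polynomial, from `ζ`
  obtain ⟨a₁, ha₁, -, hΛ₁⟩ := exists_norm_eq_one_norm_add_mul_pow_lt_one p hϖ he hp2 hζ hζ1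
  obtain ⟨x₁, hx₁, hφ₁⟩ := exists_ne_zero_addPoly_eq_zero_of_norm p C ha₁ hΛ₁
  -- `#k = p`, so the residue polynomial vanishes identically
  have hcard : Nat.card (ResidueField (Valued.integer K)) = p := by
    rw [card_residueField p K, hf, pow_one]
  have h0 := forall_addPoly_eq_zero_of_natCard_eq p _ hcard hx₁ hφ₁
  have hK := norm_add_mul_pow_lt_one_of_forall_addPoly_eq_zero p C h0
  -- every principal unit has `L` in `𝔪²`, hence every unit
  have hprin : ∀ y : K, IsPrincipal y → ‖logSeries y‖ ≤ ‖(ϖ : K)‖ ^ 2 := by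
    intro y hy
    obtain ⟨a, ha, rfl⟩ := exists_eq_one_add_mul_of_isPrincipal hϖ hy
    exact norm_logSeries_le_sq_of_norm_lt_one p hϖ he hp2 ha (hK a ha)
  rintro _ ⟨u, hu, rfl⟩
  rw [Set.mem_setOf_eq] at hu
  rw [mem_closedBall, dist_zero_right]
  obtain ⟨m, hm, hpm, hmP⟩ := exists_pow_isPrincipal_not_dvd (p := p) hu
  rw [unitLog_eq_inv_mul_logSeries p hm hmP, norm_mul, norm_inv]
  have hm1 : ‖((m : ℕ) : K)‖ = 1 := by
    rw [norm_natCast_eq_padicNorm p K m, Padic.norm_natCast_eq_one_iff]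
    exact (Nat.Prime.coprime_iff_not_dvd hp.out).mpr hpm
  rw [hm1, inv_one, one_mul]
  exact hprin _ hmP

/-! ## (W3) `ζ_p ∈ K`, `f ≥ 2`: `log_p(𝒪^×)` is not an `𝒪`-module -/

omit hϖ in
/-- At `e = p − 1`, `p` odd, `f ≥ 2`: **`log_p(𝒪_K^×) ⊄ 𝔪²`** (whether or not `ζ_p ∈ K`): otherwise the
residue polynomial `ā ↦ ā + c̄·ā^p` (`c̄ ≠ 0`) would vanish on a field with more than `p` elements.
[cite: Washington1997, §5.1] -/
theorem not_logUnits_subset_closedBall_sq_of_two_le_residueDegree {ϖ : Kˣ} (hϖ : IsUniformizer ϖ)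
    (hp2 : p ≠ 2) (hf : 2 ≤ residueDegree p K) :
    ¬ logUnits K ⊆ closedBall (0 : K) (‖(ϖ : K)‖ ^ 2) := by
  intro hsub
  have hc1 := norm_coeff_eq_one p hϖ he
  let C : Valued.integer K := ⟨(ϖ : K) ^ (p - 1) / p, Valued.integer.mem_iff.mpr hc1.le⟩
  haveI := charP_residueField p K
  haveI : Finite (ResidueField (Valued.integer K)) := finite_residueField
  have hK : ∀ a : K, ‖a‖ ≤ 1 → ‖a + (C : K) * a ^ p‖ < 1 := by
    intro a ha
    have hyP : IsPrincipal (1 + (ϖ : K) * a) := by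
      rw [IsPrincipal, sub_add_cancel_left, norm_neg, norm_mul]
      exact (mul_le_of_le_one_right (norm_nonneg _) ha).trans_lt hϖ.norm_lt_one
    have hmem : logSeries (1 + (ϖ : K) * a) ∈ logUnits K := by
      rw [← unitLog_of_isPrincipal p hyP]; exact unitLog_mem_logUnits hyP.norm_eq_one
    have hL : ‖logSeries (1 + (ϖ : K) * a)‖ ≤ ‖(ϖ : K)‖ ^ 2 := by
      have := hsub hmem; rwa [mem_closedBall, dist_zero_right] at this
    exact norm_lt_one_of_norm_logSeries_le_sq p hϖ he hp2 ha hL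
  have h0 := forall_addPoly_eq_zero_of_norm p C hK
  have hγ : residue (Valued.integer K) C ≠ 0 := residue_ne_zero_of_norm_eq_one C hc1
  have hle := natCard_le_of_forall_addPoly_eq_zero p hγ h0
  rw [card_residueField p K] at hle
  have h2 : p ^ 2 ≤ p ^ residueDegree p K := Nat.pow_le_pow_right hp.out.pos hf
  have hlt : p < p ^ 2 := by
    rw [pow_two]
    exact lt_mul_self hp.out.one_lt
  omega

omit hϖ in
/-- At `e = p − 1`, `p` odd, `f ≥ 2`: **`log_p(𝒪_K^×)` contains an element of norm exactly `‖ϖ‖`.**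
[cite: Washington1997, §5.1] -/
theorem exists_mem_logUnits_norm_eq {ϖ : Kˣ} (hϖ : IsUniformizer ϖ) (hp2 : p ≠ 2)
    (hf : 2 ≤ residueDegree p K) : ∃ z ∈ logUnits K, ‖z‖ = ‖(ϖ : K)‖ := by
  obtain ⟨z, hz, hzn⟩ := Set.not_subset.mp
    (not_logUnits_subset_closedBall_sq_of_two_le_residueDegree p he hϖ hp2 hf)
  rw [mem_closedBall, dist_zero_right, not_le] at hzn
  have hz' := logUnits_subset_closedBall p hϖ he hz
  rw [mem_closedBall, dist_zero_right] at hz'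
  exact ⟨z, hz, norm_eq_of_sq_lt_of_le hϖ hzn hz'⟩

/-- **(W3)** At `e = p − 1`, `p` odd: if `K` contains a non-trivial `p`-th root of unity `ζ` and has residue
degree `f ≥ 2` then **`log_p(𝒪_K^×)` is NOT stable under multiplication by `𝒪_K`** (it is a
`ℤ_p`-lattice strictly between `𝔪²` and `𝔪` that is no `𝒪_K`-module).  Proof: were it `𝒪`-stable, it
would contain `𝔪` (it has an element of norm `‖ϖ‖`), so every `b ∈ 𝒪` would be `a + c·a^p (mod 𝔪)`: the
residue polynomial would be onto hence one-to-one — but `(ζ−1)/ϖ` is a non-zero zero.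
[cite: Washington1997, Lemma 1.4, §5.1] [cite: NeukirchANT1999, Ch. II Prop. (5.7)] -/
theorem exists_mul_not_mem_logUnits (hp2 : p ≠ 2) {ζ : K} (hζ : ζ ^ p = 1) (hζ1 : ζ ≠ 1)
    (hf : 2 ≤ residueDegree p K) : ∃ a z : K, ‖a‖ ≤ 1 ∧ z ∈ logUnits K ∧ a * z ∉ logUnits K := by
  by_contra hstab
  push Not at hstab
  have hc1 := norm_coeff_eq_one p hϖ he
  let C : Valued.integer K := ⟨(ϖ : K) ^ (p - 1) / p, Valued.integer.mem_iff.mpr hc1.le⟩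
  haveI := charP_residueField p K
  haveI : Finite (ResidueField (Valued.integer K)) := finite_residueField
  -- (i) an element of norm `‖ϖ‖`, hence `𝔪 ⊆ log_p(𝒪^×)` by stability
  obtain ⟨z, hz, hzn⟩ := exists_mem_logUnits_norm_eq p he hϖ hp2 hf
  have hz0 : z ≠ 0 := norm_pos_iff.mp (by rw [hzn]; exact norm_units_pos ϖ)
  have hball : ∀ w : K, ‖w‖ ≤ ‖(ϖ : K)‖ → w ∈ logUnits K := by
    intro w hw
    have hw' : w = (w / z) * z := by rw [div_mul_cancel₀ _ hz0]
    rw [hw']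
    refine hstab (w / z) z ?_ hz
    rw [norm_div, hzn]; exact (div_le_one (norm_units_pos ϖ)).mpr hw
  -- (ii) so the residue polynomial is onto, hence one-to-one
  have hsurjK : ∀ b : K, ‖b‖ ≤ 1 → ∃ a : K, ‖a‖ ≤ 1 ∧ ‖a + (C : K) * a ^ p - b‖ < 1 :=
    fun b hb => exists_norm_addPoly_sub_lt_one_of_mul_mem_logUnits p hϖ he hp2 hb
      (hball _ (by rw [norm_mul]; exact mul_le_of_le_one_right (norm_nonneg _) hb))
  have hsurj := addPoly_surjective_of_norm p C hsurjK
  have hinj := Finite.injective_iff_surjective.mpr hsurj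
  -- (iii) but `(ζ − 1)/ϖ` is a non-zero zero
  obtain ⟨a₁, ha₁, -, hΛ₁⟩ := exists_norm_eq_one_norm_add_mul_pow_lt_one p hϖ he hp2 hζ hζ1
  obtain ⟨x₁, hx₁, hφ₁⟩ := exists_ne_zero_addPoly_eq_zero_of_norm p C ha₁ hΛ₁
  refine hx₁ (hinj ?_)
  change x₁ + residue (Valued.integer K) C * x₁ ^ p = 0 + residue (Valued.integer K) C * 0 ^ p
  rw [hφ₁, zero_pow hp.out.ne_zero, mul_zero, add_zero]

/-- **(W3), lattice form for the (Ind2) ball-mover criterion**: at `e = p − 1`, `p` odd, `ζ_p ∈ K`, `f ≥ 2`,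
**no ball `{‖z‖ ≤ s}` equals `c • log_p(𝒪_K^×)` for a non-zero scalar `c ∈ ℚ_p`** (balls are `𝒪`-stable,
`c • log_p(𝒪^×)` is not).  With `c = p^k` this is the hypothesis of
`Thm311RealIsmDHMoverCriterion.exists_mem_ismDH_image_closedBall_ne_of_forall_ne`: at such places EVERY ball
`t·𝒪_v` is moved by Dupuy–Hilado's (Ind2). [cite: Washington1997, §5.1] [cite: NeukirchANT1999, Ch. II Prop. (5.7)] -/
theorem closedBall_ne_smul_logUnits (hp2 : p ≠ 2) {ζ : K} (hζ : ζ ^ p = 1) (hζ1 : ζ ≠ 1)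
    (hf : 2 ≤ residueDegree p K) (s : ℝ) {c : ℚ_[p]} (hc : c ≠ 0) :
    closedBall (0 : K) s ≠ c • logUnits K := by
  intro hEq
  obtain ⟨a, z, ha, hz, hnot⟩ := exists_mul_not_mem_logUnits p hϖ he hp2 hζ hζ1 hf
  have hL : logUnits K = closedBall (0 : K) (‖c⁻¹‖ * s) := by
    rw [← smul_zero c⁻¹, ← smul_closedBall' (inv_ne_zero hc), hEq, inv_smul_smul₀ hc]
  apply hnot
  rw [hL, mem_closedBall, dist_zero_right] at hz ⊢
  rw [norm_mul]
  exact (mul_le_of_le_one_left (norm_nonneg _) ha).trans hz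

end Literature.IUT.LogVolume

end
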